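import Mathlib
import HarnessLib
import HarnessLib.Audit
import Summits.HodgeConjecture.Statement
import Literature.AlgebraicGeometry.HodgeTheory.HodgeModelExistence
import Literature.AlgebraicGeometry.HodgeTheory.GysinFormalism
import Literature.AlgebraicGeometry.Motives.FamiliesVHS
import Literature.AlgebraicGeometry.Motives.BaseChange
import Summits.HodgeConjecture.HodgeConjecture.Theorems.HeckePrymWeilIsoInvariance
import Summits.HodgeConjecture.HodgeConjecture.Theorems.NodalSupportHodgeModels
import Literature.AlgebraicGeometry.HodgeTheory.HodgeLocus
import HarnessLib.Audit.Status.Attr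

/-!
Route: AnchorTransport

X (it suffices to show): (V = VariationalHodge) Grothendieck's variational Hodge conjecture in
global-class form — for a smooth projective family f : 𝒳 ⟶ S (IsSmoothProjectiveFamily f n) over a
smooth irreducible complex base and a class A ∈ H^{2p}(𝒳(ℂ);ℂ) whose restriction to every fibre is a
rational (p,p) class, if A|_{𝒳_{s₀}} is algebraic for ONE s₀ then A|_{𝒳_s} is algebraic for EVERY s
(CharlesSchnell2014Notes Conj. 11.3.1 = Grothendieck1966 footnote 13; by the theorem of the fixed
part a monodromy-invariant flat family of classes is the restriction of a class on the total space,
Prop. 11.3.5); and (An = AnchorExistence) every Hodge class (X, c) is such a restriction: ∃ family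
f, points s₁ s₀, an iso X ≅ 𝒳_{s₁} carrying A|_{s₁} to c, with A fibrewise Hodge and A|_{s₀}
ALGEBRAIC (an "anchor": Fermat/Delsarte member, CM point, product, degenerate or special member
where the class is known algebraic).
Lean (real carriers; Sketch.lean rc 0): `VariationalHodge ∧ AnchorExistence` over fiberOver / fiberι
/ complexBetti.map / algebraicClasses.
Assembly: (∀ n X, nonempty_hodgeModel n X) → IsoInvariance → VariationalHodge → AnchorExistence →
HodgeConjecture (c = e^*(A|_{s₁}); V transports algebraicity from s₀ to s₁; IsoInvariance (support,
provable now) moves it across the iso).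

Rationale: WHY THIS LINE (deformation theory of cycles brought to bear). Every unconditional "Hodge ⇒ (absolute
Hodge | motivated | algebraic)" theorem on record is proved by TRANSPORT along an algebraic family
from a special fibre: Deligne1982HodgeCycles (Principle B + CM points), Andre1996Motifs Thm
0.5/0.6.2, Markman2025SecantWeil (hyperholomorphic/secant sheaves deformed along the Weil locus; HC
for abelian fourfolds), Buskin-type twistor transport for K3 isometries, Bloch1972Semiregularity
(semiregular lci cycles deform with their Hodge class), BlochEsnaultKerz2014CharZero (the FORMAL
half of V holds: the obstruction to deforming a cycle class formally is exactly the Hodge condition,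
via pro-Chern character; algebraization is what is missing), BlochEsnaultKerz2014pAdic (p-adic
analogue). The route isolates the two things such proofs need in general: transport of ALGEBRAICITY
along connected Hodge loci (V) and the existence of an algebraic member on every deformation class
of a Hodge class (An). CharlesSchnell2014Notes p.480: "Very little seems to be known about the
variational Hodge conjecture" — and the remark after Thm 11.3.8 (p.482): the standard conjectures
imply V (André: motivated-ness transports unconditionally, B makes motivated = algebraic) — so V is
also the natural meeting point with the motivic line.
RANKED CRUXES. #2 VariationalHodge (mechanism: deformation/obstruction theory of cycles, perfect
complexes and K-classes — semiregularity (Bloch1972Semiregularity, BuchweitzFlenner2003, Pridham),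
pro-cdh/BEK algebraization, hyperholomorphic transport; first open arena: p = 2 on fourfold
families, non-lci cycles). #3 AnchorExistence (mechanism: GEOGRAPHY of Hodge loci — does every
component pass through a Fermat/Delsarte/CM/product/boundary member where the class is algebraic?
evidence: Movasati–Villaflor components through Fermat, Hassett divisors through special cubics;
counter-pressure: BaldiKlinglerUllmo2024 atypicality makes special points sparse). SUPPORT:
IsoInvariance (rank 9, provable now on real carriers), Target, Assembly (logic).
KILL CRITERIA. A refutation of V is a refutation of HC (V ⇐ HC, CharlesSchnell2014Notes Cor. 11.3.6)
and closes everything. The route dies AS A STRATEGY if An is refuted for a concrete (X, c) with HC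
open there — i.e. a Hodge-locus component provably containing no fibre where the class is algebraic
by any known means (then only a direct construction or route QbarEnvelope remains) — or if every
proof of an instance of V is shown to need HC on the target fibre (circularity census).
NOT DECOMPOSED YET (tenure): split of V into FormalV (BEK: done in char 0) + Algebraization
(Grothendieck existence for perfect complexes / K-classes along the Hodge locus — cards
padic-semiregular-object-lifting, semiregular-derived-freedom-anchors,
semiregular-ci-at-product-anchors); split of An by anchor type (Fermat/Delsarte: Shioda inductive
structure; CM/Shimura anchors; boundary anchors via log-semiregularity — cards
tropical-cusp-log-semiregular-lift, dt4-virtual-anchoring, supersingular-isotypic-lift); the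
MOTIVATED variant (card motivated-anchor-transport: replace V by André's Thm 0.5 + B for one total
space) once motivated classes exist on real carriers (definition request filed).

Novelty: Nearest prior art (searched/READ this session): CharlesSchnell2014Notes §11.3.1–11.3.2 (held book
cattani2014 pp.476–482: Conj. 11.3.1 VHC, Prop. 11.3.5, Cor. 11.3.6, Principle B Thm 11.3.7, remark
"standard conjectures ⇒ VHC"); Grothendieck1966 fn. 13; Bloch1972Semiregularity =
doi:10.1007/bf01390023; BlochEsnaultKerz2014CharZero = doi:10.14231/AG-2014-015 and
BlochEsnaultKerz2014pAdic = doi:10.1007/s00222-013-0461-4 (formal/p-adic VHC); Andre1996Motifs Thm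
0.5 (motivated transport); Markman2025SecantWeil = arXiv:2502.03415; idea card
motivated-anchor-transport (graded variant of André 0.5 + Deligne Principle B). Delta: none in
mechanism — "anchor + transport" is the pattern of every known absoluteness/motivatedness theorem;
the route records it as the deformation-theoretic FRAME of the summit with ALGEBRAICITY (not
motivated-ness) as the transported currency (expected grade known/variant). Added value: (i) V
stated on the tree's real carriers in the global-class form (class on the total space, fibres via
fiberOver) — equivalent to Conj. 11.3.1 by the theorem of the fixed part — so
semiregularity/BEK-type instance theorems have a decl to land against; (ii) An isolates anchor
GEOGRAPHY as a separately refutable statement (BaldiKlinglerUllmo2024 sparsity is the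
counter-pressure), the place where the 20-odd 'anchor' idea cards of this summit dedup; (iii)
explicit junction with the motivic line (B ⇒ V).  [refs: 10.1007/bf01390023, 10.14231/AG-2014-015, 10.1007/s00222-013-0461-4, 2502.03415, doi:10.1007/bf01390023, doi:10.14231/AG-2014-015, doi:10.1007/s00222-013-0461-4, Grothendieck1966, BaldiKlinglerUllmo2024]

Barriers (technique_class: variational-hodge, anchor-transport, semiregularity): technique_class: variational-hodge, anchor-transport, semiregularity
- Literature.Barriers.HodgeConjecture.CattaniDeligneKaplan1995_hodgeLocus_algebraicFor: an INPUT,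
not an obstacle — algebraicity of Hodge-locus components is what makes "deformation class of a Hodge
class" an algebraic family, as V requires (V is FALSE over analytic simply-connected bases:
CharlesSchnell2014Notes remark after Conj. 11.3.2 — hence the base S is a smooth irreducible
ℂ-scheme in the decl).
- Literature.Barriers.HodgeConjecture.Voisin2003_generalHypersurface_noIntegralClassInF (normal
functions / Jacobi inversion): evaded — no Abel–Jacobi inversion, no J = J_alg hypothesis; transport
is of CLASSES along the Hodge locus, cycles enter only at the anchor and through deformation theory
of the cycle/complex itself (semiregularity), not through intermediate Jacobians.
- Literature.Barriers.HodgeConjecture.Clemens1983_griffithsGroup_infiniteRank: evaded — no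
finiteness/representability of cycle groups is assumed; V concerns homological classes only.
- Literature.Barriers.HodgeConjecture.Zucker1977_kaehlerTorus_noAnalyticCycles /
Voisin2002_weilTorus_hodgeClassWithoutSubvarieties (Kähler-only methods fail): evaded — families are
algebraic (IsSmoothProjectiveFamily), anchors are algebraic cycles; projectivity enters through CDK
and the theorem of the fixed part.
- Literature.Barriers.HodgeConjecture.Andre1996_hodgeClassesOnAbelianVarieties_motivated /
hodgeClassesAreAbsoluteFor_abelianVariety: consistent

Novelty grade: variant — ROUTE REVIEW (refuter, 2026-08-15). Novelty VARIANT: 'transport along an algebraic family from an anchor fibre' is the pattern of Principle B / André motivated transport / Markman, here with ALGEBRAICITY as the transported currency — i.e. Grothendieck's variational Hodge conjecture (C–S Conj 11.3.1, (refuter refuter-rreview-route-Langlands-LiftDesc-c79f9957-0, 2026-08-15T11:22:13Z; prior: Grothendieck 1966 fn. 13 / Charles–Schnell Conj. 11.3.1, Prop. 11.3.5, Cor. 11.3.6 (cattani2014 pp. 477–479 READ), Deligne 1982 Principle B (Charles–Schnell Thm 11.3.8, p.481), Bloch 1972 semiregularity doi:10.1007/bf01390023, Bloch–Esnault–Kerz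 2014 doi:10.14231/AG-2014-015 and doi:10.1007/s00222-013-0461-4, André 1996 Thm 0.5 (motivated transport), Markman 2025 arXiv:2502.03415)

sub-problem: HodgeConjecture · status: open · opened planner-plan-HodgeConjecture-0 2026-08-15T10:50:19Z · rev 6 · ledger route-HodgeConjecture-AnchorTransport
GENERATED by the gate from the ledger (D-0016/17). Provers cite these decls: `theorem foo : Summit.HodgeConjecture.HodgeConjecture.Theses.AnchorTransport.<Decl> := …` in Summits/HodgeConjecture/HodgeConjecture/Theorems/<Name>.lean.
-/

namespace Summit.HodgeConjecture.HodgeConjecture.Theses.AnchorTransport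

open scoped BigOperators Topology Manifold Classical MeasureTheory ProbabilityTheory Matrix InnerProductSpace ComplexConjugate ContinuousMap
open Filter Set Function TopologicalSpace MeasureTheory

attribute [summit_statement] _root_.HodgeConjecture

/-- item stmt-HodgeConjecture-1079 · target · rank 0 · open · by planner
why it might fail: X = V ∧ An is equivalent in strength to HC (HC ⇒ each conjunct; V → An → HC by the Assembly with IsoInvariance and nonempty_hodgeModel): X fails iff HC fails; as a strategy it dies if An is refuted for one (X,c) with HC open there, or if every instance of V needs HC on the target fibre.
sources: CharlesSchnell2014Notes, Grothendieck1966
[target] X = VariationalHodge ∧ AnchorExistence (transport of algebraicity along algebraic families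
+ an algebraic member in every deformation class of a Hodge class). -/
@[route_item "route-HodgeConjecture-AnchorTransport"]
def Target : Prop :=
  (∀ ⦃n : ℕ⦄ ⦃𝒳 S : Literature.AlgebraicGeometry.Motives.SchemeOver ℂ⦄ (f : 𝒳 ⟶ S), Literature.AlgebraicGeometry.Motives.IsSmoothProjectiveFamily f n → IrreducibleSpace S.left → AlgebraicGeometry.Smooth S.hom → ∀ (p : ℕ) (A : Literature.AlgebraicGeometry.HodgeTheory.complexBetti 𝒳 (2 * p)), (∀ s : Literature.AlgebraicGeometry.Motives.ComplexPoints S, Literature.AlgebraicGeometry.HodgeTheory.IsRationalClass (Literature.AlgebraicGeometry.HodgeTheory.complexBetti.map (Literature.AlgebraicGeometry.Motives.fiberι f s) (2 * p) A) ∧ Literature.AlgebraicGeometry.HodgeTheory.IsOfHodgeType n (Literature.AlgebraicGeometry.Motives.fiberOver f s) (2 * p) p p (Literature.AlgebraicGeometry.HodgeTheory.complexBetti.map (Literature.AlgebraicGeometry.Motives.fiberι f s) (2 * p) A)) → (∃ s₀ : Literature.AlgebraicGeometry.Motives.ComplexPoints S, Literature.AlgebraicGeometry.HodgeTheory.complexBetti.map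 (Literature.AlgebraicGeometry.Motives.fiberι f s₀) (2 * p) A ∈ Literature.AlgebraicGeometry.HodgeTheory.algebraicClasses (Literature.AlgebraicGeometry.Motives.fiberOver f s₀) p) → ∀ s : Literature.AlgebraicGeometry.Motives.ComplexPoints S, Literature.AlgebraicGeometry.HodgeTheory.complexBetti.map (Literature.AlgebraicGeometry.Motives.fiberι f s) (2 * p) A ∈ Literature.AlgebraicGeometry.HodgeTheory.algebraicClasses (Literature.AlgebraicGeometry.Motives.fiberOver f s) p) ∧ (∀ ⦃n : ℕ⦄ ⦃X : Literature.AlgebraicGeometry.Motives.SchemeOver ℂ⦄, Literature.AlgebraicGeometry.Motives.IsSmoothProjective n X → ∀ (p : ℕ) (c : Literature.AlgebraicGeometry.HodgeTheory.complexBetti X (2 * p)), Literature.AlgebraicGeometry.HodgeTheory.IsRationalClass c → Literature.AlgebraicGeometry.HodgeTheory.IsOfHodgeType n X (2 * p) p p c → ∃ (𝒳 S : Literature.AlgebraicGeometry.Motives.SchemeOver ℂ) (f : 𝒳 ⟶ S) (s₁ s₀ : Literature.AlgebraicGeometry.Motives.ComplexPoints S) (e : X ≅ Literature.AlgebraicGeometry.Motives.fiberOver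 f s₁) (A : Literature.AlgebraicGeometry.HodgeTheory.complexBetti 𝒳 (2 * p)), Literature.AlgebraicGeometry.Motives.IsSmoothProjectiveFamily f n ∧ IrreducibleSpace S.left ∧ AlgebraicGeometry.Smooth S.hom ∧ (∀ s : Literature.AlgebraicGeometry.Motives.ComplexPoints S, Literature.AlgebraicGeometry.HodgeTheory.IsRationalClass (Literature.AlgebraicGeometry.HodgeTheory.complexBetti.map (Literature.AlgebraicGeometry.Motives.fiberι f s) (2 * p) A) ∧ Literature.AlgebraicGeometry.HodgeTheory.IsOfHodgeType n (Literature.AlgebraicGeometry.Motives.fiberOver f s) (2 * p) p p (Literature.AlgebraicGeometry.HodgeTheory.complexBetti.map (Literature.AlgebraicGeometry.Motives.fiberι f s) (2 * p) A)) ∧ Literature.AlgebraicGeometry.HodgeTheory.complexBetti.map e.hom (2 * p) (Literature.AlgebraicGeometry.HodgeTheory.complexBetti.map (Literature.AlgebraicGeometry.Motives.fiberι f s₁) (2 * p) A) = c ∧ Literature.AlgebraicGeometry.HodgeTheory.complexBetti.map (Literature.AlgebraicGeometry.Motives.fiberι f s₀) (2 * p) A ∈ Literature.AlgebraicGeometry.HodgeTheory.algebraicClasses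 (Literature.AlgebraicGeometry.Motives.fiberOver f s₀) p)

/-- item stmt-HodgeConjecture-1076 · crux · rank 2 · open · by planner
why it might fail: V ⇐ HC (CharlesSchnell Cor 11.3.6): false only with HC. The line can stall: the one general mechanism, semiregularity (Bloch1972, BuchweitzFlenner2003, Pridham2024), needs semiregular lci representatives 'general principles do not give, except for divisors' (VoisinTorino1994 L3); BEK2014 is formal.
sources: CharlesSchnell2014Notes, Grothendieck1966, Bloch1972Semiregularity, VoisinTorino1994, BuchweitzFlenner2003, Pridham2024
[crux] Grothendieck's VARIATIONAL HODGE CONJECTURE, global-class form on real carriers: f : 𝒳 ⟶ S a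
smooth projective family of relative dimension n over a smooth irreducible ℂ-scheme S, A ∈
H^{2p}(𝒳(ℂ);ℂ) with every fibre restriction A|_{𝒳_s} a rational (p,p) class; if A|_{𝒳_{s₀}} is
algebraic for one s₀ then for all s. Equivalent to CharlesSchnell2014Notes Conj. 11.3.1 (=
Grothendieck1966 footnote 13): a monodromy-invariant flat section of R^{2p}f_*ℚ is the restriction
of a class on the total space (theorem of the fixed part, Deligne Hodge II 4.1.1; Prop. 11.3.5), and
a flat family of Hodge classes becomes invariant after a finite étale base change. Known:
semiregular lci cycles (Bloch1972Semiregularity; BuchweitzFlenner2003 semiregularity map; Pridham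
derived version), formal/infinitesimal part in char 0 (BlochEsnaultKerz2014CharZero: obstruction =
Hodge condition; algebraization missing), p-adic analogue (BlochEsnaultKerz2014pAdic), standard
conjectures ⇒ V (André, via CharlesSchnell2014Notes remark after Thm 11.3.8), Weil classes along the
Weil locus in dim 4 (Markman2025SecantWeil). HC ⇒ V (Cor. 11.3.6). False over analytic
simply-connected bases (remark after Conj. 11.3.2) — -/
@[route_item "route-HodgeConjecture-AnchorTransport", crux]
def VariationalHodge : Prop :=
  ∀ ⦃n : ℕ⦄ ⦃𝒳 S : Literature.AlgebraicGeometry.Motives.SchemeOver ℂ⦄ (f : 𝒳 ⟶ S), Literature.AlgebraicGeometry.Motives.IsSmoothProjectiveFamily f n → IrreducibleSpace S.left → AlgebraicGeometry.Smooth S.hom → ∀ (p : ℕ) (A : Literature.AlgebraicGeometry.HodgeTheory.complexBetti 𝒳 (2 * p)), (∀ s : Literature.AlgebraicGeometry.Motives.ComplexPoints S, Literature.AlgebraicGeometry.HodgeTheory.IsRationalClass (Literature.AlgebraicGeometry.HodgeTheory.complexBetti.map (Literature.AlgebraicGeometry.Motives.fiberι f s) (2 * p) A) ∧ Literature.AlgebraicGeometry.HodgeTheory.IsOfHodgeType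 n (Literature.AlgebraicGeometry.Motives.fiberOver f s) (2 * p) p p (Literature.AlgebraicGeometry.HodgeTheory.complexBetti.map (Literature.AlgebraicGeometry.Motives.fiberι f s) (2 * p) A)) → (∃ s₀ : Literature.AlgebraicGeometry.Motives.ComplexPoints S, Literature.AlgebraicGeometry.HodgeTheory.complexBetti.map (Literature.AlgebraicGeometry.Motives.fiberι f s₀) (2 * p) A ∈ Literature.AlgebraicGeometry.HodgeTheory.algebraicClasses (Literature.AlgebraicGeometry.Motives.fiberOver f s₀) p) → ∀ s : Literature.AlgebraicGeometry.Motives.ComplexPoints S, Literature.AlgebraicGeometry.HodgeTheory.complexBetti.map (Literature.AlgebraicGeometry.Motives.fiberι f s) (2 * p) A ∈ Literature.AlgebraicGeometry.HodgeTheory.algebraicClasses (Literature.AlgebraicGeometry.Motives.fiberOver f s) p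

/-- item stmt-HodgeConjecture-1077 · crux · rank 3 · open · by planner
why it might fail: As stated An(X,c) ⇐ 'c algebraic' (constant family; s₁ = s₀ allowed), so ¬An ⇒ ¬HC: refutable only by disproving HC. Strategic failure: a Hodge-locus component through (X,c) meeting no Fermat/CM/product/boundary member where algebraicity is KNOWN (BKU2024: special points sparse).
sources: CattaniDeligneKaplan1995JAMS, BaldiKlinglerUllmo2024, Shioda1979HodgeFermat, Deligne1982HodgeCycles, Markman2025SecantWeil, Zucker1977
[crux] ANCHOR EXISTENCE (geography of Hodge loci): every rational (p,p) class c on a smooth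
projective X is, up to an iso X ≅ 𝒳_{s₁}, the restriction of a class A on the total space of a
smooth projective family f : 𝒳 ⟶ S over a smooth irreducible base, with A fibrewise rational (p,p)
and A|_{𝒳_{s₀}} ALGEBRAIC at some s₀ — i.e. the connected algebraic deformation class of (X, c)
through Hodge classes (a component of the CDK Hodge locus, made invariant by finite base change)
contains a member where the class is known algebraic: Fermat/Delsarte members (Shioda1979HodgeFermat
inductive structure), CM points and Weil loci (Deligne1982HodgeCycles, Markman2025SecantWeil),
products, special cubic fourfolds (Zucker1977), degenerate/boundary members. Trivially true when c
is already algebraic (constant family). Counter-pressure: special points are sparse in level ≥ 3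
(BaldiKlinglerUllmo2024). -/
@[route_item "route-HodgeConjecture-AnchorTransport", crux]
def AnchorExistence : Prop :=
  ∀ ⦃n : ℕ⦄ ⦃X : Literature.AlgebraicGeometry.Motives.SchemeOver ℂ⦄, Literature.AlgebraicGeometry.Motives.IsSmoothProjective n X → ∀ (p : ℕ) (c : Literature.AlgebraicGeometry.HodgeTheory.complexBetti X (2 * p)), Literature.AlgebraicGeometry.HodgeTheory.IsRationalClass c → Literature.AlgebraicGeometry.HodgeTheory.IsOfHodgeType n X (2 * p) p p c → ∃ (𝒳 S : Literature.AlgebraicGeometry.Motives.SchemeOver ℂ) (f : 𝒳 ⟶ S) (s₁ s₀ : Literature.AlgebraicGeometry.Motives.ComplexPoints S) (e : X ≅ Literature.AlgebraicGeometry.Motives.fiberOver f s₁) (A : Literature.AlgebraicGeometry.HodgeTheory.complexBetti 𝒳 (2 * p)), Literature.AlgebraicGeometry.Motives.IsSmoothProjectiveFamily f n ∧ IrreducibleSpace S.left ∧ AlgebraicGeometry.Smooth S.hom ∧ (∀ s : Literature.AlgebraicGeometry.Motives.ComplexPoints S, Literature.AlgebraicGeometry.HodgeTheory.IsRationalClass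 (Literature.AlgebraicGeometry.HodgeTheory.complexBetti.map (Literature.AlgebraicGeometry.Motives.fiberι f s) (2 * p) A) ∧ Literature.AlgebraicGeometry.HodgeTheory.IsOfHodgeType n (Literature.AlgebraicGeometry.Motives.fiberOver f s) (2 * p) p p (Literature.AlgebraicGeometry.HodgeTheory.complexBetti.map (Literature.AlgebraicGeometry.Motives.fiberι f s) (2 * p) A)) ∧ Literature.AlgebraicGeometry.HodgeTheory.complexBetti.map e.hom (2 * p) (Literature.AlgebraicGeometry.HodgeTheory.complexBetti.map (Literature.AlgebraicGeometry.Motives.fiberι f s₁) (2 * p) A) = c ∧ Literature.AlgebraicGeometry.HodgeTheory.complexBetti.map (Literature.AlgebraicGeometry.Motives.fiberι f s₀) (2 * p) A ∈ Literature.AlgebraicGeometry.HodgeTheory.algebraicClasses (Literature.AlgebraicGeometry.Motives.fiberOver f s₀) p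

/-- item stmt-HodgeConjecture-16363 · support · rank 4 · open · by planner
why it might fail: A 1971 theorem: only its TYPING can fail — `Continuous σ` (étalé topology of FiberClass) must mean 'flat section' (Ehresmann on ComplexPoints carriers, unproved in tree). Real risk = size: residue = Deligne's log-de Rham MHS, W_k = Im i^* (snc core of Voisin II 4.23); 2 discharges bounced.
sources: DeligneHodgeII1971, VoisinHodgeII2003, CharlesSchnell2014Notes, Deligne1968, Voisin2007HodgeLoci
[crux] PROMOTED NAMED FACT (route-choice repair 2026-08-16, harness-requested: the Literature fact
`HodgeTheory.deligne_globalInvariantCycles` was judged XL-apex — too large for one prover seat, and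
non-crux facts are not split — after two discharge attempts bounced; it is load-bearing for crux
#3's only live line). Deligne's global invariant cycle theorem / théorème de la partie fixe (Hodge
II Thm 4.1.1; Voisin II Thm 4.24; Charles–Schnell Thm 11.3.4), hard inclusion, ℂ-coefficients,
pointwise, on the real carriers of HodgeLocus.lean: for a smooth projective family f : 𝒳 ⟶ S of
relative dimension n over a smooth quasi-projective complex base (quasi-projectivity INLINED as ∃
open ℂ-immersion into a projective ℂ-scheme — Iff.rfl with HodgeTheory.IsQuasiProjectiveOver S — so
the route imports only HodgeLocus, never the fact file) and an open immersion i : 𝒳 ⟶ 𝒳̄ into a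
smooth projective 𝒳̄, every continuous section σ of the étalé space FiberClass f k (a global =
monodromy-invariant section of Rᵏ f_* ℂ) takes at each s₀ the value of the restriction of some A ∈
Hᵏ(𝒳̄(ℂ); ℂ): σ s₀ = globalSection f k (i^* A) s₀. VERBATIM the body of the named fact (planner
SketchIff.lean: Iff.rfl, lean -/
@[route_item "route-HodgeConjecture-AnchorTransport"]
def DeligneGlobalInvariantCycles : Prop :=
  ∀ (𝒳 Xbar S : Literature.AlgebraicGeometry.Motives.SchemeOver ℂ) (f : 𝒳 ⟶ S) (i : 𝒳 ⟶ Xbar) (n m : ℕ), Literature.AlgebraicGeometry.Motives.IsSmoothProjectiveFamily f n → (∃ (P : Literature.AlgebraicGeometry.Motives.SchemeOver ℂ) (j : S ⟶ P), Literature.AlgebraicGeometry.Motives.IsProjectiveOver P ∧ AlgebraicGeometry.IsOpenImmersion j.left) → AlgebraicGeometry.Smooth S.hom → Literature.AlgebraicGeometry.Motives.IsProjectiveOver Xbar → AlgebraicGeometry.SmoothOfRelativeDimension m Xbar.hom → AlgebraicGeometry.IsOpenImmersion i.left → ∀ (k : ℕ) (σ : Literature.AlgebraicGeometry.Motives.ComplexPoints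 S → Literature.AlgebraicGeometry.HodgeTheory.FiberClass f k), Continuous σ → (∀ s, (σ s).pt = s) → ∀ s₀ : Literature.AlgebraicGeometry.Motives.ComplexPoints S, ∃ A : Literature.AlgebraicGeometry.HodgeTheory.complexBetti Xbar k, σ s₀ = Literature.AlgebraicGeometry.HodgeTheory.globalSection f k (Literature.AlgebraicGeometry.HodgeTheory.complexBetti.map i k A) s₀

/-- item stmt-HodgeConjecture-1078 · support · rank 9 · closed · proved by Summit.HodgeConjecture.HodgeConjecture.Theorems.isoInvariance_proof (prover) · by planner
sources: Fulton1998
[support] Algebraic classes are transported by isomorphisms of ℂ-schemes: for e : X ≅ Y,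
e^*(algebraicClasses Y p) ⊆ algebraicClasses X p. Provable now on the tree's carriers: e induces a
homeomorphism of complex points (AlgPoints.mapContinuous functoriality) and a bijection of closed
subsets preserving codimension (Order.coheight is invariant under the order-isomorphism of
underlying spaces), so kernels of restriction maps correspond (singularCohomology.map
functoriality). -/
@[route_item "route-HodgeConjecture-AnchorTransport", crux]
def IsoInvariance : Prop :=
  ∀ ⦃X Y : Literature.AlgebraicGeometry.Motives.SchemeOver ℂ⦄ (e : X ≅ Y) (p : ℕ) (c : Literature.AlgebraicGeometry.HodgeTheory.complexBetti Y (2 * p)), c ∈ Literature.AlgebraicGeometry.HodgeTheory.algebraicClasses Y p → Literature.AlgebraicGeometry.HodgeTheory.complexBetti.map e.hom (2 * p) c ∈ Literature.AlgebraicGeometry.HodgeTheory.algebraicClasses X p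

/-- `IsoInvariance` holds: proved by `Summit.HodgeConjecture.HodgeConjecture.Theorems.isoInvariance_proof`. -/
theorem IsoInvariance_holds : IsoInvariance := _root_.Summit.HodgeConjecture.HodgeConjecture.Theorems.isoInvariance_proof

/-- item stmt-HodgeConjecture-14224 · support · rank 9 · closed · proved by Summit.HodgeConjecture.HodgeConjecture.Theorems.anchorTransport_targetOfCruxes_proof (prover) · by planner
[support] GLUE to the target (route-choice repair 2026-08-16, option (a), hold reason
target-unreachable): the frame statement X = Target (= VariationalHodge ∧ AnchorExistence, with both
bodies inlined verbatim) follows from the two cruxes. Pure logic, provable now in one line — `fun hV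
hAn => ⟨hV, hAn⟩` — because `Target` unfolds to `(VariationalHodge-body) ∧ (AnchorExistence-body)`
on the nose (planner Sketch.lean, lean check rc 0, 2026-08-16). With this item the route graph is
connected both ways: cruxes → Target (this glue) and cruxes → _root_.HodgeConjecture (deciding
theorem `closes hV hAn hIso hM`, certified native 2026-08-15T16:16Z); equivalently `closes hT.1 hT.2
hIso hM : Target → IsoInvariance → HodgeModels → HodgeConjecture`. No mathematical content beyond
bookkeeping; anyone idle may close it. [deps: VariationalHodge, AnchorExistence, Target]
[difficulty: provable-now] -/
@[route_item "route-HodgeConjecture-AnchorTransport"]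
def TargetOfCruxes : Prop :=
  VariationalHodge → AnchorExistence → Target

/-- item stmt-HodgeConjecture-1943 · support · rank 9 · closed · proved by Summit.HodgeConjecture.HodgeConjecture.Theorems.nodalSupport_hodgeModels_proof @ 6468568b8792 (prover) · by planner
[support] needs-fact: Literature.AlgebraicGeometry.HodgeTheory.nonempty_hodgeModel (route-repair,
cone guardrail 2026-08-15). GENUINELY needed: `Nonempty (HodgeModel n X)` is conjunct 1 of
HodgeTheory.HodgeConjectureFor, i.e. part of the summit statement itself, so every route to
HodgeConjecture must produce it. This decl is VERBATIM the first antecedent of this route's Assembly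
(and of NodalSupport's and QbarEnvelope's — re-ask this exact signature there to share the item); it
is filed as an item so that the closing chain is items-only (`Assembly_holds HodgeModels_holds
IsoInvariance_holds VariationalHodge_holds AnchorExistence_holds : HodgeConjecture` typechecks with
no unfolding; planner Sketch.lean rc 0, where `HodgeModels ↔ ∀ n X, IsSmoothProjective n X →
Nonempty (HodgeModel n X)` is Iff.rfl) and so that the fact is named in the ledger as tier-0 debt of
the summit. HOW IT CLOSES: one line, `fun n X => nonempty_hodgeModel_holds`, once the Literature
fact is discharged — the reduction is already in tree:
HodgeModelExistenceDischarge.nonempty_hodgeModel_of_deRham_of_hodgeDecomposition (remaining leaves: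
the real de Rham theorem exists_deRhamIsoFamily and the Hodge decomposition -/
@[route_item "route-HodgeConjecture-AnchorTransport", crux]
def HodgeModels : Prop :=
  ∀ (n : ℕ) (X : Literature.AlgebraicGeometry.Motives.SchemeOver ℂ), Literature.AlgebraicGeometry.HodgeTheory.nonempty_hodgeModel n X

/-- `HodgeModels` holds: proved by `Summit.HodgeConjecture.HodgeConjecture.Theorems.nodalSupport_hodgeModels_proof` @ 6468568b8792. -/
theorem HodgeModels_holds : HodgeModels := _root_.Summit.HodgeConjecture.HodgeConjecture.Theorems.nodalSupport_hodgeModels_proof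

/-- item stmt-HodgeConjecture-1080 · assembly · rank 1 · closed · proved by Summit.HodgeConjecture.HodgeConjecture.Theorems.anchorTransport_assembly_proof (prover) · by planner
[assembly] Given X smooth projective and a rational (p,p) class c: AnchorExistence gives (f, s₁, s₀,
e, A); VariationalHodge (with the anchor s₀) gives A|_{𝒳_{s₁}} ∈ algebraicClasses; IsoInvariance
along e gives c = e^*(A|_{𝒳_{s₁}}) ∈ algebraicClasses X p; the HodgeModel conjunct is the antecedent
fact. Pure logic; provable now. -/
@[route_item "route-HodgeConjecture-AnchorTransport"]
def Assembly : Prop :=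
  (∀ (n : ℕ) (X : Literature.AlgebraicGeometry.Motives.SchemeOver ℂ), Literature.AlgebraicGeometry.HodgeTheory.nonempty_hodgeModel n X) → IsoInvariance → VariationalHodge → AnchorExistence → _root_.HodgeConjecture

/-! D-0027 §2.1 — DECIDING THEOREM (planner-authored via `route open/edit --closes-file`; by planner-rbadge-HodgeConjecture-AnchorTransport-c53a3374-g2-0 2026-08-15T16:16:33Z):
its hypotheses are this route's items and its conclusion the sub-problem Statement (glue_lint), and it elaborates with this file. -/

@[closes "route-HodgeConjecture-AnchorTransport"] theorem closes (hV : VariationalHodge) (hAn : AnchorExistence) (hIso : IsoInvariance)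
    (hM : HodgeModels) : _root_.HodgeConjecture := by
  intro n X hX
  refine (Literature.AlgebraicGeometry.HodgeTheory.hodgeConjectureFor_iff_of_isSmoothProjective
    (hM n X) hX).2 ?_
  intro p c hc hpp
  obtain ⟨𝒳, S, f, s₁, s₀, e, A, hf, hirr, hsm, hfib, hAc, hs₀⟩ := hAn hX p c hc hpp
  -- transport algebraicity from the anchor fibre s₀ to the fibre s₁ (variational Hodge) …
  have h₁ := hV f hf hirr hsm p A hfib ⟨s₀, hs₀⟩ s₁
  -- … and across the isomorphism e : X ≅ 𝒳_{s₁}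
  have h₂ := hIso e p _ h₁
  rw [hAc] at h₂
  exact h₂

end Summit.HodgeConjecture.HodgeConjecture.Theses.AnchorTransport
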